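import Mathlib.Analysis.SpecialFunctions.Complex.Circle
import Mathlib.Analysis.SpecialFunctions.Sqrt
import HarnessLib

/-!
# Coordinate discs of the quarter-arc charts lie in angular boxes

Topic `Literature/Topology/FourManifolds` (fact seat of the Seiberg–Witten leaf
`Literature.Barriers.SmoothPoincare4.akhmedovPark2010_lemma8_invariants`; block 2 of
Akhmedov–Park's `X₁(m)`, A. Akhmedov, B. D. Park, Invent. Math. 181 (2010), §3).  The local
models at the plumbing points of `Σ̄₂` live in coordinate discs `{‖a‖ < R}` of the quarter-arc
charts `a = c′ · Im((z θ⁻¹)²)/Re((z θ⁻¹)²)` (`TorusQuarterChart.lean`), while the framing functions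
(`BraidAxisFraming.lean`) are exact on ANGULAR BOXES `{Re (z θ⁻¹) ≥ 1 - ε}`.  This file provides
the elementary containments between the two, as facts about a point `w` of the unit circle:

* `re_ge_of_abs_quarterCoord_le` — `Re w > 0`, `Re w² > 0`, `|Im w²/Re w²| ≤ t ≤ 1` imply
  `Re w ≥ 1 - t²/2` (small quarter coordinate ⇒ inside the box);
* `re_ge_of_abs_halfCoord_le` — `Re w > 0`, `|Im w/Re w| ≤ t ≤ 1` imply `Re w ≥ 1 - t²/2`;
* `abs_im_le_of_re_ge` — `Re w ≥ 1 - ε` implies `|Im w| ≤ √(2ε)` (inside the box ⇒ small angle).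

Everything is proved; no definitions.

## References

* A. Akhmedov, B. D. Park, Invent. Math. 181 (2010) 577–603 = arXiv:math/0701829, §3. [AkhmedovPark2010]
-/

noncomputable section

open Complex

namespace Literature.Topology.FourManifolds

namespace CoordinateBoxes

/-- If `X > 0`, `X² + Y² = 1` and `|Y| ≤ t X` with `0 ≤ t ≤ 1`, then `X ≥ 1 - t²/2`. [folklore] -/
theorem ge_one_sub_of_abs_le_mul {X Y t : ℝ} (hX : 0 < X) (h1 : X ^ 2 + Y ^ 2 = 1) (ht : 0 ≤ t)
    (ht1 : t ≤ 1) (hY : |Y| ≤ t * X) : 1 - t ^ 2 / 2 ≤ X := by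
  have hY2 : Y ^ 2 ≤ (t * X) ^ 2 := by
    rw [← sq_abs Y]
    exact pow_le_pow_left₀ (abs_nonneg Y) hY 2
  -- `X² (1 + t²) ≥ 1`
  have hge : 1 ≤ X ^ 2 * (1 + t ^ 2) := by nlinarith
  -- compare with `(1 - t²/2)² (1 + t²) ≤ 1`
  have hu1 : t ^ 2 ≤ 1 := by nlinarith
  have hcmp : (1 - t ^ 2 / 2) ^ 2 * (1 + t ^ 2) ≤ 1 := by
    have hid : (1 - t ^ 2 / 2) ^ 2 * (1 + t ^ 2) = 1 - (t ^ 2) ^ 2 * (3 - t ^ 2) / 4 := by ring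
    rw [hid]
    have : 0 ≤ (t ^ 2) ^ 2 * (3 - t ^ 2) := mul_nonneg (sq_nonneg _) (by linarith)
    linarith
  have h0 : 0 ≤ 1 - t ^ 2 / 2 := by nlinarith
  by_contra h
  push Not at h
  have : X ^ 2 * (1 + t ^ 2) < (1 - t ^ 2 / 2) ^ 2 * (1 + t ^ 2) := by
    have hX2 : X ^ 2 < (1 - t ^ 2 / 2) ^ 2 := by nlinarith
    exact mul_lt_mul_of_pos_right hX2 (by positivity)
  linarith

/-- **Small quarter coordinate ⇒ inside the angular box**: for a point `w` of the unit circle with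
`Re w > 0`, `Re w² > 0` and `|Im w²/Re w²| ≤ t ≤ 1`, `Re w ≥ 1 - t²/2`. [folklore] -/
theorem re_ge_of_abs_quarterCoord_le {w : Circle} {t : ℝ} (ht : 0 ≤ t) (ht1 : t ≤ 1)
    (hre : 0 < (w : ℂ).re) (hre2 : 0 < (((w : ℂ)) ^ 2).re)
    (h : |(((w : ℂ)) ^ 2).im / (((w : ℂ)) ^ 2).re| ≤ t) : 1 - t ^ 2 / 2 ≤ (w : ℂ).re := by
  have hsq : ∀ z : Circle, (z : ℂ).re ^ 2 + (z : ℂ).im ^ 2 = 1 := fun z => by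
    have h1 : ‖(z : ℂ)‖ ^ 2 = 1 := by rw [Circle.norm_coe, one_pow]
    rw [Complex.sq_norm, Complex.normSq_apply] at h1
    nlinarith [h1]
  have hw2 : (((w ^ 2 : Circle)) : ℂ) = ((w : ℂ)) ^ 2 := Circle.coe_pow w 2
  have h1 : (((w : ℂ)) ^ 2).re ^ 2 + (((w : ℂ)) ^ 2).im ^ 2 = 1 := by rw [← hw2]; exact hsq (w ^ 2)
  have hY : |(((w : ℂ)) ^ 2).im| ≤ t * (((w : ℂ)) ^ 2).re := by
    rwa [abs_div, abs_of_pos hre2, div_le_iff₀ hre2] at h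
  have hX := ge_one_sub_of_abs_le_mul hre2 h1 ht ht1 hY
  -- `Re w ≥ Re w² = 2 Re² - 1` on `[0, 1]`
  have hx := hsq w
  have hre' : (((w : ℂ)) ^ 2).re = 2 * (w : ℂ).re ^ 2 - 1 := by
    rw [sq, Complex.mul_re]; nlinarith
  have hle1 : (w : ℂ).re ≤ 1 := by nlinarith
  nlinarith

/-- **Small half coordinate ⇒ inside the box**: `Re w > 0`, `|Im w/Re w| ≤ t ≤ 1` imply
`Re w ≥ 1 - t²/2`. [folklore] -/
theorem re_ge_of_abs_halfCoord_le {w : Circle} {t : ℝ} (ht : 0 ≤ t) (ht1 : t ≤ 1)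
    (hre : 0 < (w : ℂ).re) (h : |((w : ℂ)).im / ((w : ℂ)).re| ≤ t) : 1 - t ^ 2 / 2 ≤ (w : ℂ).re := by
  have h1 : (w : ℂ).re ^ 2 + (w : ℂ).im ^ 2 = 1 := by
    have h1 : ‖(w : ℂ)‖ ^ 2 = 1 := by rw [Circle.norm_coe, one_pow]
    rw [Complex.sq_norm, Complex.normSq_apply] at h1
    nlinarith [h1]
  have hY : |((w : ℂ)).im| ≤ t * ((w : ℂ)).re := by
    rwa [abs_div, abs_of_pos hre, div_le_iff₀ hre] at h
  exact ge_one_sub_of_abs_le_mul hre h1 ht ht1 hY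

/-- **Inside the box ⇒ small angle**: `Re w ≥ 1 - ε` (`0 ≤ ε`) implies `|Im w| ≤ √(2ε)` and
`Im w ² ≤ 2ε`. [folklore] -/
theorem abs_im_le_of_re_ge {w : Circle} {ε : ℝ} (hε : 0 ≤ ε) (h : 1 - ε ≤ (w : ℂ).re) :
    (w : ℂ).im ^ 2 ≤ 2 * ε ∧ |(w : ℂ).im| ≤ Real.sqrt (2 * ε) := by
  have h1 : (w : ℂ).re ^ 2 + (w : ℂ).im ^ 2 = 1 := by
    have h1 : ‖(w : ℂ)‖ ^ 2 = 1 := by rw [Circle.norm_coe, one_pow]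
    rw [Complex.sq_norm, Complex.normSq_apply] at h1
    nlinarith [h1]
  have hle1 : (w : ℂ).re ≤ 1 := by nlinarith
  have him : (w : ℂ).im ^ 2 ≤ 2 * ε := by nlinarith
  refine ⟨him, ?_⟩
  rw [← Real.sqrt_sq_eq_abs]
  exact Real.sqrt_le_sqrt him

end CoordinateBoxes

end Literature.Topology.FourManifolds
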